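import Literature.Barriers.PneNP.NPHardnessToOneWayFunctionsMsg3Form
import HarnessLib

/-!
# Barrier `NPHardnessToOneWayFunctions` (AGGM 2006, Thm. 4): reading the prover's responses

App. D campaign (design v3), machine part M2'-i (the verdict), of the discharge of
`Literature.Barriers.PneNP.AkaviaEtAl2006_complMemAM`.

The verdict `verdictSpec` (`…Verifier.lean`) reads the prover's two responses through the
decoders `dec₁` / `dec₂` of the message code (`…MsgCode.lean`). This file expresses every field
the verdict uses as a READ AT A FIXED WINDOW of the normalised response strings
`m₁' = m₁.takeD Lm`, `m₃' = m₃.takeD Lm`: the claims of the run and pool positions (`optRead`,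
`clR_eq`, `clP_eq`), the bucket lists (`lists_eq`), the lower-bound test responses
(`rRC_eq`, `rRS_eq`, `rPC_eq`, `rPS_eq`: layouts read at the offsets `oRC … oPS`) and the
secret-test candidate sets (`ahC_eq`, `ahS_eq`: the first `len` blocks, as a `Finset`). All
proved, no named facts.

## References

* [AkaviaEtAl2006] A. Akavia, O. Goldreich, S. Goldwasser, D. Moshkovitz, *On basing one-way
  functions on NP-hardness*, STOC 2006; preprint App. D (printed p. 21).
-/

noncomputable section

namespace Literature.Barriers.PneNP

open Finset Literature.Computability.Complexity Literature.Computability.Complexity.AffineHash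
  Literature.Computability.Cryptography BitLayout BitFormat

open scoped Classical

namespace AppD

open Sizes Par

/-! ### Generic reads -/

/-- A layout, as a format, reads at a window what the layout reads at the offset. [folklore] -/
theorem read_ofLayout_ofListAt {α : Type*} {N : ℕ} (L : BitLayout α N) (l : List Bool) (off : ℕ) :
    (ofLayout L).read (ofListAt N l off) = L.readAt l off := rfl

/-- **An optional exponent read at `off`**: presence bit, then `eb` value bits. [folklore] -/
def optRead (l : List Bool) (off eb : ℕ) : Option ℕ := if l.getD off false then some (bitsToNat (sliceD l (off + 1) eb)) else none

/-- A claim read at a window is the pair of optional reads. [folklore] -/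
theorem read_claimFmt_ofListAt (eb : ℕ) (l : List Bool) (off : ℕ) :
    (claimFmt eb).read (ofListAt ((1 + eb) + (1 + eb)) l off) = (optRead l off eb, optRead l (off + (1 + eb)) eb) := by
  unfold claimFmt optRead
  apply Prod.ext
  · rw [read_prod_ofListAt_fst, read_option_ofListAt]; split_ifs <;> simp [read_natB_ofListAt_eq_bitsToNat]
  · rw [read_prod_ofListAt_snd, read_option_ofListAt]; split_ifs <;> simp [read_natB_ofListAt_eq_bitsToNat]

/-- `eC` / `eS` of a read claim. [folklore] -/
theorem eC_eS_optRead (l : List Bool) (off eb : ℕ) :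
    eC (optRead l off eb, optRead l (off + (1 + eb)) eb) = (optRead l off eb).getD 0 ∧
    eS (optRead l off eb, optRead l (off + (1 + eb)) eb) = (optRead l (off + (1 + eb)) eb).getD 0 := ⟨rfl, rfl⟩

/-- A bit of a slice. [folklore] -/
theorem getD_sliceD (l : List Bool) (off k : ℕ) (i : Fin k) : (sliceD l off k).getD i false = l.getD (off + i) false := by
  unfold sliceD; simp

/-- A `zvec` read is `vvOfList` of the slice. [folklore] -/
theorem readAt_zvec_eq_vvOfList (k : ℕ) (l : List Bool) (off : ℕ) : (BitLayout.zvec k).readAt l off = vvOfList k (sliceD l off k) := by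
  funext i
  rw [readAt_zvec]
  unfold vvOfList
  rw [getD_sliceD]
  cases l.getD (off + i) false <;> rfl

section Read

variable (R : OracleAdversary Bool) (f : List Bool → List Bool) (hq : R.QueriesOfInputLength) (x : List Bool)

/-! ### The claims -/

/-- **The claim of run position `q`**, read from `m₁`. [folklore] -/
theorem clR_eq (m₁ : List Bool) (q : (Sw R f hq x).RPos) :
    ((Kx R f hq x).dec₁ (vecOf R x m₁)).clR q =
      (optRead (m₁.takeD (Lm R x) false) ((finProdFinEquiv q : ℕ) * wCl R x) (ebitsOf R x),
       optRead (m₁.takeD (Lm R x) false) ((finProdFinEquiv q : ℕ) * wCl R x + (1 + ebitsOf R x)) (ebitsOf R x)) := by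
  have hread : ((Kx R f hq x).dec₁ (vecOf R x m₁)).clR q =
      (claimFmt (ebitsOf R x)).read (ofListAt _ (m₁.takeD (Lm R x) false) (0 + (finProdFinEquiv q : ℕ) * wCl R x)) := by
    show ((resp1Fmt R f x hq (fbitsOf R x.length) (fuel_le R x.length) (Iw R x) (ebitsOf R x)).read
      (ofList _ (m₁.takeD (Lm R x) false))).clR q = _
    unfold resp1Fmt len₁'
    rw [ofList_eq_ofListAt, read_ofEquiv]
    simp only [resp1Equiv, Equiv.coe_fn_symm_mk]
    rw [read_prod_ofListAt_fst, read_ofEquiv]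
    simp only [rposEquiv, Equiv.arrowCongr, Equiv.coe_fn_symm_mk, Equiv.refl_symm, Equiv.coe_refl, Function.comp_apply, id_eq]
    erw [read_pi_ofListAt]
    rfl
  rw [hread, Nat.zero_add, read_claimFmt_ofListAt]

/-- **The claim of pool position `j`**, read from `m₁`. [folklore] -/
theorem clP_eq (m₁ : List Bool) (j : Fin (Iw R x).prm.M) :
    ((Kx R f hq x).dec₁ (vecOf R x m₁)).clP j =
      (optRead (m₁.takeD (Lm R x) false) (offClP R x j) (ebitsOf R x), optRead (m₁.takeD (Lm R x) false) (offClP R x j + (1 + ebitsOf R x)) (ebitsOf R x)) := by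
  have hread : ((Kx R f hq x).dec₁ (vecOf R x m₁)).clP j =
      (claimFmt (ebitsOf R x)).read (ofListAt _ (m₁.takeD (Lm R x) false) (0 + (Iw R x).prm.m * 2 ^ fbitsOf R x.length * wCl R x + j * wCl R x)) := by
    show ((resp1Fmt R f x hq (fbitsOf R x.length) (fuel_le R x.length) (Iw R x) (ebitsOf R x)).read
      (ofList _ (m₁.takeD (Lm R x) false))).clP j = _
    unfold resp1Fmt len₁'
    rw [ofList_eq_ofListAt, read_ofEquiv]
    simp only [resp1Equiv, Equiv.coe_fn_symm_mk]
    rw [read_prod_ofListAt_snd]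
    erw [read_pi_ofListAt]
  rw [hread, Nat.zero_add, read_claimFmt_ofListAt]

/-! ### The offsets of response 2 -/

/-- Width of a seed (coin, pad, slot bits): `cn + n + fbits`. [folklore] -/
abbrev dS : ℕ := R.coins.eval x.length + x.length + fbitsOf R x.length
/-- Width of one bucket list: `size cap + cap · n`. [folklore] -/
abbrev wL : ℕ := Nat.size (Iw R x).prm.cap + (Iw R x).prm.cap * x.length
/-- Width of one lower-bound response on seeds. [folklore] -/
abbrev wGC : ℕ := (Iw R x).u * ((Iw R x).prm.c * dS R x + ((Iw R x).kmaxG - 1))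
/-- Width of one lower-bound response on `𝔽₂ⁿ`. [folklore] -/
abbrev wGS : ℕ := (Iw R x).u * ((Iw R x).prm.c * x.length + ((Iw R x).kmaxG - 1))
/-- Width of one occurrence candidate set. [folklore] -/
abbrev wAHC : ℕ := Nat.size (bmaxOf R x) + bmaxOf R x * dS R x
/-- Width of one preimage candidate set. [folklore] -/
abbrev wAHS : ℕ := Nat.size (bmaxOf R x) + bmaxOf R x * x.length
/-- Offset of the runs' occurrence responses. [folklore] -/
abbrev oRC : ℕ := (Iw R x).prm.m * 2 ^ fbitsOf R x.length * wL R x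
/-- Offset of the runs' preimage responses. [folklore] -/
abbrev oRS : ℕ := oRC R x + (Iw R x).prm.m * 2 ^ fbitsOf R x.length * wGC R x
/-- Offset of the pool's occurrence responses. [folklore] -/
abbrev oPC : ℕ := oRS R x + (Iw R x).prm.m * 2 ^ fbitsOf R x.length * wGS R x
/-- Offset of the pool's preimage responses. [folklore] -/
abbrev oPS : ℕ := oPC R x + (Iw R x).prm.M * wGC R x
/-- Offset of the occurrence candidate sets. [folklore] -/
abbrev oAHC : ℕ := oPS R x + (Iw R x).prm.M * wGS R x
/-- Offset of the preimage candidate sets. [folklore] -/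
abbrev oAHS : ℕ := oAHC R x + (Iw R x).prm.M * wAHC R x

/-- The normalised third response. [folklore] -/
abbrev m3n (m₃ : List Bool) : List Bool := m₃.takeD (Lm R x) false

/-- `dec₂` reads `resp2Fmt` on the normalised string. [folklore] -/
theorem dec₂_eq (m₃ : List Bool) : (Kx R f hq x).dec₂ (vecOf R x m₃) =
    (resp2Fmt R f x hq (fbitsOf R x.length) (fuel_le R x.length) (Iw R x) (bmaxOf R x)).read (ofListAt _ (m3n R x m₃) 0) := by
  show (resp2Fmt R f x hq (fbitsOf R x.length) (fuel_le R x.length) (Iw R x) (bmaxOf R x)).read (ofList _ (m3n R x m₃)) = _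
  rw [ofList_eq_ofListAt]

/-! ### The bucket lists -/

/-- **The bucket list of run position `q`**, read from `m₃`: the first `len` of `cap` blocks of `n` bits. [folklore] -/
theorem lists_eq (m₃ : List Bool) (q : (Sw R f hq x).RPos) :
    ((Kx R f hq x).dec₂ (vecOf R x m₃)).lists q =
      (List.ofFn fun i : Fin (Iw R x).prm.cap => vvOfList x.length (sliceD (m3n R x m₃)
        ((finProdFinEquiv q : ℕ) * wL R x + Nat.size (Iw R x).prm.cap + i * x.length) x.length)).take
      (bitsToNat (sliceD (m3n R x m₃) ((finProdFinEquiv q : ℕ) * wL R x) (Nat.size (Iw R x).prm.cap))) := by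
  rw [dec₂_eq]
  unfold resp2Fmt len₂'
  rw [read_ofEquiv]
  simp only [resp2Equiv, Equiv.coe_fn_symm_mk]
  rw [read_prod_ofListAt_fst, read_ofEquiv]
  simp only [rposEquiv, Equiv.arrowCongr, Equiv.coe_fn_symm_mk, Equiv.refl_symm, Equiv.coe_refl, Function.comp_apply, id_eq]
  erw [read_pi_ofListAt]
  unfold blist
  simp only [Nat.zero_add, split_ofListAt]
  rw [read_natB_ofListAt_eq_bitsToNat]
  congr 1
  congr 1; funext i
  erw [read_pi_ofListAt]
  unfold vvFmt
  rw [read_ofLayout_ofListAt, readAt_zvec_eq_vvOfList]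
  congr 2

/-! ### The lower-bound test responses -/

/-- **The runs' occurrence responses**, read from `m₃`. [folklore] -/
theorem rRC_eq (m₃ : List Bool) (q : (Sw R f hq x).RPos) :
    ((Kx R f hq x).dec₂ (vecOf R x m₃)).rRC q =
      (gsRespLayout (seedLayout R x (fbitsOf R x.length)) (Iw R x).prm.c (Iw R x).kmaxG (Iw R x).u).readAt (m3n R x m₃)
        (oRC R x + (finProdFinEquiv q : ℕ) * wGC R x) := by
  rw [dec₂_eq]
  unfold resp2Fmt len₂'
  rw [read_ofEquiv]
  simp only [resp2Equiv, Equiv.coe_fn_symm_mk]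
  rw [read_prod_ofListAt_snd, read_prod_ofListAt_fst, read_ofLayout_ofListAt, readAt_ofEquiv]
  simp only [rposEquiv, Equiv.arrowCongr, Equiv.coe_fn_symm_mk, Equiv.refl_symm, Equiv.coe_refl, Function.comp_apply, id_eq]
  erw [readAt_pi]
  simp only [Nat.zero_add]
  rfl

/-- **The runs' preimage responses**, read from `m₃`. [folklore] -/
theorem rRS_eq (m₃ : List Bool) (q : (Sw R f hq x).RPos) :
    ((Kx R f hq x).dec₂ (vecOf R x m₃)).rRS q =
      (gsRespLayout (BitLayout.zvec x.length) (Iw R x).prm.c (Iw R x).kmaxG (Iw R x).u).readAt (m3n R x m₃)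
        (oRS R x + (finProdFinEquiv q : ℕ) * wGS R x) := by
  rw [dec₂_eq]
  unfold resp2Fmt len₂'
  rw [read_ofEquiv]
  simp only [resp2Equiv, Equiv.coe_fn_symm_mk]
  rw [read_prod_ofListAt_snd, read_prod_ofListAt_snd, read_prod_ofListAt_fst, read_ofLayout_ofListAt, readAt_ofEquiv]
  simp only [rposEquiv, Equiv.arrowCongr, Equiv.coe_fn_symm_mk, Equiv.refl_symm, Equiv.coe_refl, Function.comp_apply, id_eq]
  erw [readAt_pi]
  simp only [Nat.zero_add]
  rfl

/-- **The pool's occurrence responses**, read from `m₃`. [folklore] -/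
theorem rPC_eq (m₃ : List Bool) (j : Fin (Iw R x).prm.M) :
    ((Kx R f hq x).dec₂ (vecOf R x m₃)).rPC j =
      (gsRespLayout (seedLayout R x (fbitsOf R x.length)) (Iw R x).prm.c (Iw R x).kmaxG (Iw R x).u).readAt (m3n R x m₃) (oPC R x + j * wGC R x) := by
  rw [dec₂_eq]
  unfold resp2Fmt len₂'
  rw [read_ofEquiv]
  simp only [resp2Equiv, Equiv.coe_fn_symm_mk]
  rw [read_prod_ofListAt_snd, read_prod_ofListAt_snd, read_prod_ofListAt_snd, read_prod_ofListAt_fst, read_ofLayout_ofListAt]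
  erw [readAt_pi]
  simp only [Nat.zero_add]

/-- **The pool's preimage responses**, read from `m₃`. [folklore] -/
theorem rPS_eq (m₃ : List Bool) (j : Fin (Iw R x).prm.M) :
    ((Kx R f hq x).dec₂ (vecOf R x m₃)).rPS j =
      (gsRespLayout (BitLayout.zvec x.length) (Iw R x).prm.c (Iw R x).kmaxG (Iw R x).u).readAt (m3n R x m₃) (oPS R x + j * wGS R x) := by
  rw [dec₂_eq]
  unfold resp2Fmt len₂'
  rw [read_ofEquiv]
  simp only [resp2Equiv, Equiv.coe_fn_symm_mk]
  rw [read_prod_ofListAt_snd, read_prod_ofListAt_snd, read_prod_ofListAt_snd, read_prod_ofListAt_snd, read_prod_ofListAt_fst,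
    read_ofLayout_ofListAt]
  erw [readAt_pi]
  simp only [Nat.zero_add]

/-! ### The secret-test candidate sets -/

/-- **The occurrence candidate set of `j`**, read from `m₃`: the first `len` of `bmax` seed blocks. [folklore] -/
theorem ahC_eq (m₃ : List Bool) (j : Fin (Iw R x).prm.M) :
    ((Kx R f hq x).dec₂ (vecOf R x m₃)).ahC j =
      ((List.ofFn fun i : Fin (bmaxOf R x) => (seedLayout R x (fbitsOf R x.length)).readAt (m3n R x m₃)
        (oAHC R x + j * wAHC R x + Nat.size (bmaxOf R x) + i * dS R x)).take
        (bitsToNat (sliceD (m3n R x m₃) (oAHC R x + j * wAHC R x) (Nat.size (bmaxOf R x))))).toFinset := by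
  rw [dec₂_eq]
  unfold resp2Fmt len₂'
  rw [read_ofEquiv]
  simp only [resp2Equiv, Equiv.coe_fn_symm_mk]
  rw [read_prod_ofListAt_snd, read_prod_ofListAt_snd, read_prod_ofListAt_snd, read_prod_ofListAt_snd, read_prod_ofListAt_snd,
    read_prod_ofListAt_fst]
  erw [read_pi_ofListAt]
  unfold bfinset blist
  simp only [Nat.zero_add, split_ofListAt]
  rw [read_natB_ofListAt_eq_bitsToNat]
  congr 1; congr 1
  congr 1; funext i
  erw [read_pi_ofListAt]
  unfold cfFmt
  rw [read_ofLayout_ofListAt]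

/-- **The preimage candidate set of `j`**, read from `m₃`. [folklore] -/
theorem ahS_eq (m₃ : List Bool) (j : Fin (Iw R x).prm.M) :
    ((Kx R f hq x).dec₂ (vecOf R x m₃)).ahS j =
      ((List.ofFn fun i : Fin (bmaxOf R x) => vvOfList x.length (sliceD (m3n R x m₃)
        (oAHS R x + j * wAHS R x + Nat.size (bmaxOf R x) + i * x.length) x.length)).take
        (bitsToNat (sliceD (m3n R x m₃) (oAHS R x + j * wAHS R x) (Nat.size (bmaxOf R x))))).toFinset := by
  rw [dec₂_eq]
  unfold resp2Fmt len₂'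
  rw [read_ofEquiv]
  simp only [resp2Equiv, Equiv.coe_fn_symm_mk]
  rw [read_prod_ofListAt_snd, read_prod_ofListAt_snd, read_prod_ofListAt_snd, read_prod_ofListAt_snd, read_prod_ofListAt_snd,
    read_prod_ofListAt_snd]
  erw [read_pi_ofListAt]
  unfold bfinset blist
  simp only [Nat.zero_add, split_ofListAt]
  rw [read_natB_ofListAt_eq_bitsToNat]
  congr 1; congr 1
  congr 1; funext i
  erw [read_pi_ofListAt]
  unfold vvFmt
  rw [read_ofLayout_ofListAt, readAt_zvec_eq_vvOfList]

end Read

end AppD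

end Literature.Barriers.PneNP

end
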